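import Mathlib
import Summits.Ventures.PercRepro.TriangleCapFourRowFour
import Summits.Ventures.PercRepro.TriangleCapFiveRowFour
import Summits.Ventures.PercRepro.TriangleCapThreeRowSecondBestCherries

/-!
# PercRepro — THE SECOND-BEST TABLE AT `r = 4` ON THE ROWS `a = 3, 4, 5` IN ONE STATEMENT, AND THE CHERRY FORMS
(p3, gen 46; part 199y)

`second_best_r_four (3 ≤ a ≤ 5) (2a + 4 ≤ k) (11 ≤ k)`: the second-best value of `Σ_v d(v)²` over the non-extremal
`K₄⁻`-free graphs on `Fin k` with `a (k − a) − 4` edges is EXACTLY `m k − 4 (k − 5) − 4` — the row `a = 3` is part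
193 (`three_row_second_best`, `secondGapThree k 4 = 4`), the rows `a = 4, 5` are parts 199r and 199x; in the table's
cherry coordinates (`2 · cherries = Σ d² − 2m`, `sum_deg_sq_le_iff_cherries`): `cherry_table_second_best_r_four`.
Axioms: standard.
-/

namespace PercRepro

namespace TriangleCap

namespace C047

open Finset

/-- `m k = m (k − 2) + 2m` for `2 ≤ k`. -/
theorem mul_sub_two_add (m k : ℕ) (hk : 2 ≤ k) : m * (k - 2) + 2 * m = m * k := by
  have h := Nat.sub_add_cancel hk
  calc m * (k - 2) + 2 * m = m * ((k - 2) + 2) := by ring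
    _ = m * k := by rw [h]

/-- **THE SECOND-BEST VALUE AT `r = 4` ON THE ROWS `a = 3, 4, 5`:** for `2a + 4 ≤ k`, `11 ≤ k`, every non-extremal
`K₄⁻`-free graph on `Fin k` with `a (k − a) − 4` edges has `Σ_v d(v)² + 4 (k − 5) + 4 ≤ m k`, and the value is
attained. -/
theorem second_best_r_four (a k : ℕ) (ha3 : 3 ≤ a) (ha5 : a ≤ 5) (hk : 2 * a + 4 ≤ k) (hk11 : 11 ≤ k) :
    (∀ (D : SimpleGraph (Fin k)) [DecidableRel D.Adj], K4mFree D → D.edgeFinset.card + 4 = a * (k - a) →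
        ∑ v, deg D v * deg D v + 4 * (k - 5) ≠ D.edgeFinset.card * k →
        ∑ v, deg D v * deg D v + 4 * (k - 5) + 4 ≤ D.edgeFinset.card * k) ∧
      ∃ (D : SimpleGraph (Fin k)) (_ : DecidableRel D.Adj), K4mFree D ∧ D.edgeFinset.card + 4 = a * (k - a) ∧
        ∑ v, deg D v * deg D v + 4 * (k - 5) + 4 = D.edgeFinset.card * k := by
  interval_cases a
  · -- the row `a = 3`: part 193 at `r = 4`
    obtain ⟨h1, D, inst, hK, hE, hS⟩ := three_row_second_best k 4 (by norm_num) (by omega)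
    have hgap : secondGapThree k 4 = 4 := by
      unfold secondGapThree
      norm_num
    rw [hgap] at h1 hS
    have e : k - 1 - 4 = k - 5 := by omega
    rw [e] at h1 hS
    refine ⟨?_, D, inst, hK, by omega, hS⟩
    intro D' _ hK' hm' hne
    exact h1 D' hK' (by omega) hne
  · exact four_four_second_best k (by omega)
  · exact five_four_second_best k (by omega)

/-- The same in the table's cherry coordinates: `2 · cherries + 4 (k − 5) + 4 ≤ m (k − 2)` for every non-extremal
graph, with equality attained. -/
theorem cherry_table_second_best_r_four (a k : ℕ) (ha3 : 3 ≤ a) (ha5 : a ≤ 5) (hk : 2 * a + 4 ≤ k) (hk11 : 11 ≤ k) :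
    (∀ (D : SimpleGraph (Fin k)) [DecidableRel D.Adj], K4mFree D → D.edgeFinset.card + 4 = a * (k - a) →
        2 * cherries D + 4 * (k - 5) ≠ D.edgeFinset.card * (k - 2) →
        2 * cherries D + 4 * (k - 5) + 4 ≤ D.edgeFinset.card * (k - 2)) ∧
      ∃ (D : SimpleGraph (Fin k)) (_ : DecidableRel D.Adj), K4mFree D ∧ D.edgeFinset.card + 4 = a * (k - a) ∧
        2 * cherries D + 4 * (k - 5) + 4 = D.edgeFinset.card * (k - 2) := by
  have hcard : Fintype.card (Fin k) = k := Fintype.card_fin k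
  obtain ⟨h1, D, inst, hK, hE, hS⟩ := second_best_r_four a k ha3 ha5 hk hk11
  refine ⟨?_, D, inst, hK, hE, ?_⟩
  · intro D' _ hK' hm' hne
    have hiff := sum_deg_sq_le_iff_cherries D' (4 * (k - 5) + 4) (by rw [hcard]; omega)
    rw [hcard] at hiff
    have hiff2 := sum_deg_sq_le_iff_cherries D' (4 * (k - 5)) (by rw [hcard]; omega)
    rw [hcard] at hiff2
    have hne' : ∑ v, deg D' v * deg D' v + 4 * (k - 5) ≠ D'.edgeFinset.card * k := by
      intro heq
      have hle := hiff2.mp (le_of_eq heq)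
      -- the closed form is the maximum: `≤` both ways
      have hge : D'.edgeFinset.card * (k - 2) ≤ 2 * cherries D' + 4 * (k - 5) := by
        have hsd := sum_deg_eq D'
        have hcl : 2 * cherries D' + 2 * D'.edgeFinset.card = ∑ v, deg D' v * deg D' v := by
          unfold cherries
          rw [mul_sum, ← hsd, ← sum_add_distrib]
          apply sum_congr rfl
          intro v _
          rw [Nat.choose_two_right]
          have := Nat.div_mul_cancel (Nat.even_mul_pred_self (deg D' v)).two_dvd
          rw [Nat.mul_comm] at this
          have h2 : deg D' v * (deg D' v - 1) + deg D' v = deg D' v * deg D' v := by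
            rcases Nat.eq_zero_or_pos (deg D' v) with h | h
            · rw [h]
            · have := Nat.succ_pred_eq_of_pos h
              nlinarith [Nat.sub_add_cancel h]
          omega
        have hk2 := mul_sub_two_add D'.edgeFinset.card k (by omega)
        omega
      exact hne (le_antisymm hle hge)
    exact hiff.mp (h1 D' hK' hm' hne')
  · have hiff := sum_deg_sq_le_iff_cherries D (4 * (k - 5) + 4) (by rw [hcard]; omega)
    rw [hcard] at hiff
    have hle := hiff.mp (le_of_eq hS)
    -- the reverse inequality from the closed-form bound
    have hcl : 2 * cherries D + 2 * D.edgeFinset.card = ∑ v, deg D v * deg D v := by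
      unfold cherries
      rw [mul_sum, ← sum_deg_eq D, ← sum_add_distrib]
      apply sum_congr rfl
      intro v _
      rw [Nat.choose_two_right]
      have := Nat.div_mul_cancel (Nat.even_mul_pred_self (deg D v)).two_dvd
      rw [Nat.mul_comm] at this
      have h2 : deg D v * (deg D v - 1) + deg D v = deg D v * deg D v := by
        rcases Nat.eq_zero_or_pos (deg D v) with h | h
        · rw [h]
        · nlinarith [Nat.sub_add_cancel h]
      omega
    have hk2 := mul_sub_two_add D.edgeFinset.card k (by omega)
    omega

end C047

end TriangleCap

end PercRepro
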